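import Summits.BirchSwinnertonDyer.BirchSwinnertonDyer.Theorems.KolyvaginDepthDoorDepthTableRowsExactReadingZhang2
import Summits.BirchSwinnertonDyer.BirchSwinnertonDyer.Theorems.Rank2Observatory681c1TwoDescRankTwo
import Summits.BirchSwinnertonDyer.BirchSwinnertonDyer.Theorems.KolyvaginDepthDoorDepthTableRowsTwoSha1
import Summits.BirchSwinnertonDyer.BirchSwinnertonDyer.Theorems.KolyvaginDepthDoorDepthTableRowKitSecondSign
import Summits.BirchSwinnertonDyer.BirchSwinnertonDyer.Theorems.Rank2ObservatoryKernelAnnihilator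
import Literature.NumberTheory.EllipticCurves.IrreducibleModPQuadraticTwistProofs
import Literature.NumberTheory.EllipticCurves.NonEisensteinPrimeOfSurjective
import Literature.NumberTheory.EllipticCurves.LeadingTermProofs
import HarnessLib

/-!
# Route `KolyvaginDepthDoor`, crux `KolyvaginDepthSupplyKN` (stmt-BirchSwinnertonDyer-22820) —
# DEPTH TABLE v12: «ONE BIT ⟺ TWO `Ш`'s» for `681c1` at the Heegner fields `d_K = −8` and `d_K = −68`
# (`p = 5` inert in both) — twist points SUPPLIED IN THE KERNEL

Helper file of the lead prover of line `levelone` (kdd-p1 g16; `--supports stmt-BirchSwinnertonDyer-22820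
--as helper`); it closes nothing and BSD is not proved by it.

The depth table's row of record for `681c1 = [0, -1, 1, 0, 2]` (`N = 3·227`, ♠ cell) is `(p, d_K, ℓ) =
(5, −83, 19)` (least JLS cost `(ℓ+1)·h_K = 60`); g15 read it rank-free («bit ⟺ `Ш(E)[5] = 0` ∧
`#Sel_5(E^{(−83)}) ≤ 5`», `exactRowZhang_5_neg83_rankFree`) but no rational point on `E^{(−83)}` is known in
the kernel (sieved search to `|u| ≤ 2·10⁸` in progress found none), so the «two `Ш`» form of that row is not
available. The exact reading holds for ANY Heegner field with `5 ∤ d_K`, and `681c1` has two further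
Heegner discriminants below `|−83|` with `5` inert: `d_K = −8` (`h_K = 1`; least Kolyvagin prime `ℓ = 109`,
`a_109 = −10`; JLS cost `110`) and `d_K = −68` (`h_K = 4`; least Kolyvagin prime `ℓ = 19`, `a_19 = −5`, the SAME
prime as the row of record; JLS cost `80`), whose twists carry SMALL points: `(36, 120)` on
`[0, 32, 0, 0, -73728]` (`= [0, −8 b₂, 0, 8·8² b₄, −16·8³ b₆]`, `u = 1/2`-isomorphic to `E^{(−8)}`) and
`(123849/4, 43776165/8)` on `[0, 272, 0, 0, -45278208]` (`E^{(−68)}`), both found by a residue-sieved search and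
both on TORSION-FREE twists (annihilator `t = 1` from two kernel point counts). This file therefore adds, for
`E = 681c1`, the rows `(5, −8)` and `(5, −68)` READ EXACTLY on W. Zhang's ♠ cell
(`kolyvaginClass_prime_ne_zero_iff_rankTwo_shaTrivial_twistSelmer_of_lemma84`, every side condition a kernel
theorem: `5` good ordinary, `ρ_{E,5^n}` onto, non-CM, ♠ (1) + semistable, Kodaira–Néron table, Heegner
hypothesis from Kronecker symbols, `rank E(ℚ) = 2` by the tree's kernel 2-descent certificate
`Rank2Observatory.C681c1.mordellWeilRank_eq_two`) and then in the «two `Ш`» currency: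

  «∃ frame, Kolyvagin prime `ℓ`, datum: `c_1(ℓ) ≠ 0`»  `↔`
  «`Ш(E/ℚ)[5] = 0` ∧ `rank_ℤ E^{(d_K)}(ℚ) = 1` ∧ `Ш(E^{(d_K)}/ℚ)[5] = 0`»   (`d_K ∈ {−8, −68}`),

for ANY imaginary quadratic `K` with that discriminant. CONDITIONAL on (γ) = Gross 1991 Prop. 3.7 (2) and
W. Zhang 2014 Lemma 8.4 (1) / Thm. 9.1 BY NAME; per curve; BSD is NOT proved by any of this. With
`…DepthTableRow655a1TwoSha` (g16) every one of the 15 rank-certified curves of the table now has a row in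
the «two `Ш`» currency (13 at the field of record, `655a1` at `−51`, `681c1` here at `−8`/`−68`).

References: [WZhang2014] Lemma 8.4 (1) (p. 236), Thm. 9.1 (p. 240), Hypothesis ♠ (p. 195); [GrossLMS1991]
Prop. 3.7 (2); [SilvermanAEC2009] VII.3.1 (b), VIII.6.7, X.4.2, X.5 Cor. 5.4; [JetchevLauterStein2009] §3.6
(arXiv:0707.0032); [Marcus1977] Ch. 3 Thm. 25; [CremonaAlgorithms1997] Table 1 (681c1), §3.5, §3.6.
-/

set_option linter.dupNamespace false

noncomputable section

open scoped Classical NumberField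

namespace Summit.BirchSwinnertonDyer.BirchSwinnertonDyer.Theorems.KolyvaginDepthDoor

open Literature.NumberTheory.EllipticCurves Literature.NumberTheory.EllipticCurves.ModularForms
  WeierstrassCurve NumberField IsDedekindDomain
open Summit.BirchSwinnertonDyer.BirchSwinnertonDyer.Theorems
open Summit.BirchSwinnertonDyer.BirchSwinnertonDyer.Rank2Observatory

namespace C681c1

/-! ## Row `(5, −8)`: Heegner data, exact reading, twist model `[0, 32, 0, 0, -73728]`, kernel point `(36, 120)` -/

/-- **Heegner data `d_K = -8` for `681c1`**: every prime of `Δ = -2043 = -3²·227` (hence of `N_E`) splits in a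
quadratic field of discriminant `-8` (Kronecker symbols `= 1`). [cite: Marcus1977, Ch. 3 Thm. 25] [cite: GrossLMS1991, §1] -/
theorem heegner_neg8 : ∀ q : ℕ, q.Prime → (q : ℤ) ∣ (⟨0, -1, 1, 0, 2⟩ : WeierstrassCurve ℤ).Δ →
    (q = 2 → (-8 : ℤ) % 8 = 1) ∧ (q ≠ 2 → jacobiSym (-8) q = 1) :=
  forall_prime_dvd_of_natAbs_eq_pow_mul_pow (a := 3) (i := 2) (b := 227) (j := 1) (by decide +kernel)
    (by norm_num) (by norm_num) ⟨by norm_num, by norm_num⟩ ⟨by norm_num, by norm_num⟩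

/-- **DEPTH-TABLE ROW `681c1`, `(p, d_K) = (5, −8)`, READ EXACTLY on the ♠ cell (two-sided; no `hF`, no
twist point, no twist pinning; `5` inert in `K`; `h_K = 1`, least Kolyvagin prime `ℓ = 109`, `a_109 = -10`,
JLS cost `(ℓ+1)·h_K = 110`).** For `E = 681c1` (two independent points by `KernelCerts002.C681c1.two_le_rank`)
and ANY imaginary quadratic `K` with `d_K = −8`: «some frame, some Kolyvagin prime `ℓ`, some datum of
conductor `ℓ` with `c_1(ℓ) ≠ 0`» `↔` «`rank E(ℚ) = 2` ∧ `Ш(E/ℚ)[5] = 0` ∧ `#Sel_5(E^{(−8)}/ℚ) ≤ 5`». Side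
conditions all kernel theorems (`5` good ordinary, `ρ_{E,5^n}` onto, non-CM, ♠ (1) + semistable from
`Δ = -2043`, Heegner for `N_E`). CONDITIONAL on (γ) and W. Zhang's Lemma 8.4 (1) / Thm. 9.1 by name; per
curve; BSD is not proved by it.
[cite: WZhang2014, Lemma 8.4 (1) (p. 236), Thm. 9.1 (p. 240)] [cite: GrossLMS1991, Prop. 3.7 (2)]
[cite: JetchevLauterStein2009, §3.6 (arXiv:0707.0032)] [cite: CremonaAlgorithms1997, Table 1 (681c1)] -/
theorem exactRowZhang_5_neg8
    (h372 : GrossLMS1991.prop37_2_frobeniusCongruence)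
    (h84 : Literature.NumberTheory.EllipticCurves.WZhang2014_lemma84_exists_minimal_kolyvaginClass_one_selmerCard)
    (K : Type) [Field K] [NumberField K] (hK : IsImaginaryQuadratic K)
    (hD : NumberField.discr K = -8) :
    haveI := isElliptic_c681c1;
    haveI := isGloballyMinimal_c681c1;
    haveI : NeZero (((⟨0, -1, 1, 0, 2⟩ : WeierstrassCurve ℤ).map (Int.castRingHom ℚ)).conductorNorm ℤ) := neZero_conductorNorm_of_isElliptic _;
    haveI := Fact.mk (by norm_num : Nat.Prime 5);
    (∃ (Dt : ModularParametrizationData ((⟨0, -1, 1, 0, 2⟩ : WeierstrassCurve ℤ).map (Int.castRingHom ℚ)) (((⟨0, -1, 1, 0, 2⟩ : WeierstrassCurve ℤ).map (Int.castRingHom ℚ)).conductorNorm ℤ)) (β : ℤ)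
      (ι : K →+* ℂ) (ℓ : ℕ) (d : KolyvaginHeegnerData Dt β ι ℓ),
      ℓ.Prime ∧ Zhang2014.IsKolyvaginPrime (((⟨0, -1, 1, 0, 2⟩ : WeierstrassCurve ℤ).map (Int.castRingHom ℚ)).conductorNorm ℤ) ((⟨0, -1, 1, 0, 2⟩ : WeierstrassCurve ℤ).map (Int.castRingHom ℚ)) K 5 ℓ ∧
        d.kolyvaginClass (p := 5) (by norm_num) 1 ≠ 0) ↔
    (((⟨0, -1, 1, 0, 2⟩ : WeierstrassCurve ℤ).map (Int.castRingHom ℚ)).mordellWeilRank = 2 ∧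
      (((⟨0, -1, 1, 0, 2⟩ : WeierstrassCurve ℤ).map (Int.castRingHom ℚ)).sha ⊓ AddSubgroup.torsionBy ((⟨0, -1, 1, 0, 2⟩ : WeierstrassCurve ℤ).map (Int.castRingHom ℚ)).galH1 ((5 : ℕ) : ℤ) : AddSubgroup _) = ⊥ ∧
      Nat.card ((((⟨0, -1, 1, 0, 2⟩ : WeierstrassCurve ℤ).map (Int.castRingHom ℚ)).quadraticTwist (NumberField.discr K : ℚ)).selmerGroup (5 : ℕ)) ≤ 5) := by
  haveI := isElliptic_c681c1
  haveI := isGloballyMinimal_c681c1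
  haveI : NeZero (((⟨0, -1, 1, 0, 2⟩ : WeierstrassCurve ℤ).map (Int.castRingHom ℚ)).conductorNorm ℤ) := neZero_conductorNorm_of_isElliptic _
  haveI := Fact.mk (by norm_num : Nat.Prime 5)
  have hgo := goodOrdinary_5
  have hsp := spade_5
  have hH := satisfiesHeegnerHypothesis_conductorNorm_of_intModel intModel K hK.1 hD heegner_neg8
  have hKN := not_dvd_ordMinimalDiscriminant_of_intModel_table intModel (p := 5) (Δ₀ := -2043)
    (by decide +kernel) (B := 11) (by decide +kernel) (by decide +kernel)
  have hS2 : ¬ Squarefree (((⟨0, -1, 1, 0, 2⟩ : WeierstrassCurve ℤ).map (Int.castRingHom ℚ)).conductorNorm ℤ) →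
      (∃ (ℓ : ℕ) (_ : Fact ℓ.Prime), ((⟨0, -1, 1, 0, 2⟩ : WeierstrassCurve ℤ).map (Int.castRingHom ℚ)).HasMultiplicativeReductionAtPrime ℓ ∧
          ¬ 5 ∣ padicValInt ℓ ((⟨0, -1, 1, 0, 2⟩ : WeierstrassCurve ℤ).map (Int.castRingHom ℚ)).minimalDiscriminantInt) ∧
        ∃ (ℓ₁ ℓ₂ : ℕ) (_ : Fact ℓ₁.Prime) (_ : Fact ℓ₂.Prime), ℓ₁ ≠ ℓ₂ ∧
          ((⟨0, -1, 1, 0, 2⟩ : WeierstrassCurve ℤ).map (Int.castRingHom ℚ)).HasMultiplicativeReductionAtPrime ℓ₁ ∧ ((⟨0, -1, 1, 0, 2⟩ : WeierstrassCurve ℤ).map (Int.castRingHom ℚ)).HasMultiplicativeReductionAtPrime ℓ₂ :=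
    fun hns ↦ absurd (((⟨0, -1, 1, 0, 2⟩ : WeierstrassCurve ℤ).map (Int.castRingHom ℚ)).isSemistable_iff_squarefree_conductorNorm.mp hsp.2) hns
  have hD3 : NumberField.discr K ≠ -3 := by rw [hD]; norm_num
  have hD4 : NumberField.discr K ≠ -4 := by rw [hD]; norm_num
  have hpD : ¬ (((5 : ℕ) : ℤ) ∣ NumberField.discr K) := by rw [hD]; norm_num
  exact kolyvaginClass_prime_ne_zero_iff_rankTwo_shaTrivial_twistSelmer_of_lemma84 h372 h84 _ not_hasCM
    KernelCerts002.C681c1.two_le_rank 5 (by norm_num) hgo.1 hgo.2 hasSurjectiveModNGaloisRep_pow_5 hKN hsp.1 hS2 K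
    hK hD3 hD4 hpD hH

/-- The twist model of `E^{(−8)}` for `E = 681c1`: `[0, −8 b₂, 0, 8·8² b₄, −16·8³ b₆] = [0, 32, 0, 0, -73728]`
(`ℚ`-isomorphic to `E^{(−8)}` by `u = 1/2`). [cite: SilvermanAEC2009, X.5 Cor. 5.4] -/
theorem twistModel_neg8 :
    (⟨0, (-8) * (⟨0, -1, 1, 0, 2⟩ : WeierstrassCurve ℤ).b₂, 0, 8 * (-8) ^ 2 * (⟨0, -1, 1, 0, 2⟩ : WeierstrassCurve ℤ).b₄,
        16 * (-8) ^ 3 * (⟨0, -1, 1, 0, 2⟩ : WeierstrassCurve ℤ).b₆⟩ : WeierstrassCurve ℤ) = ⟨0, 32, 0, 0, -73728⟩ := by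
  ext <;> decide +kernel

/-- The twist model `[0, 32, 0, 0, -73728]` is an elliptic curve over `ℚ` (`Δ ≠ 0`, kernel-checked). [folklore] -/
theorem isElliptic_twist_neg8 : ((⟨0, 32, 0, 0, -73728⟩ : WeierstrassCurve ℤ).map (Int.castRingHom ℚ)).IsElliptic := by
  rw [WeierstrassCurve.isElliptic_iff, WeierstrassCurve.map_Δ, isUnit_iff_ne_zero, eq_intCast,
    Int.cast_ne_zero]
  decide +kernel

/-- Torsion killers for the twist model `[0, 32, 0, 0, -73728]`: kernel point counts `(q, #Ṽ(𝔽_q))` at the good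
primes `(5, 2), (11, 17)`. [cite: SilvermanAEC2009, Prop. VII.3.1 (b)] -/
theorem killers_twist_neg8 : ∀ ℓN ∈ [((5 : ℕ), (2 : ℕ)), ((11 : ℕ), (17 : ℕ))], ℓN.1.Prime ∧
    ∀ (x : ((⟨0, 32, 0, 0, -73728⟩ : WeierstrassCurve ℤ).map (Int.castRingHom ℚ)).toAffine.Point)
      (n : ℕ), ¬ ℓN.1 ∣ n → n • x = 0 → ℓN.2 • x = 0 :=
  killers_cons _ (q := 5) (N := 2) (by decide +kernel) (by decide +kernel)
    (killers_cons _ (q := 11) (N := 17) (by decide +kernel) (by decide +kernel)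
      (killers_nil _))

/-- **`E^{(−8)}(ℚ)` is torsion-free** (`E = 681c1`; twist model `[0, 32, 0, 0, -73728]`; annihilator `t = 1` from the
kernel counts `(5, 2), (11, 17)`). [cite: SilvermanAEC2009, Prop. VII.3.1 (b)] -/
theorem torsionFree_twist_neg8 (x : ((⟨0, 32, 0, 0, -73728⟩ : WeierstrassCurve ℤ).map (Int.castRingHom ℚ)).toAffine.Point)
    (hx : IsOfFinAddOrder x) : x = 0 := by
  simpa only [one_smul] using
    nsmul_eq_zero_of_annihilatorCheck (t := 1) killers_twist_neg8 (by decide +kernel) hx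

/-- **`1 ≤ rank_ℤ E^{(−8)}(ℚ)` for `E = 681c1` IN THE KERNEL**: the rational point `(36, 120)` of the
twist model `[0, 32, 0, 0, -73728]` (residue-sieved search, found at once) is non-zero on a torsion-free curve, hence of infinite order;
Mordell–Weil. [cite: SilvermanAEC2009, Prop. VII.3.1 (b) and Thm. VIII.6.7] -/
theorem one_le_rank_twist_neg8 :
    1 ≤ ((⟨0, 32, 0, 0, -73728⟩ : WeierstrassCurve ℤ).map (Int.castRingHom ℚ)).mordellWeilRank := by
  haveI := isElliptic_twist_neg8
  have hP : ((⟨0, 32, 0, 0, -73728⟩ : WeierstrassCurve ℤ).map (Int.castRingHom ℚ)).toAffine.Nonsingular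
      ((36 : ℚ)) ((120 : ℚ)) :=
    WeierstrassCurve.Affine.equation_iff_nonsingular.mp
      ((WeierstrassCurve.Affine.equation_iff _ _).mpr (by norm_num [WeierstrassCurve.map]))
  exact one_le_mordellWeilRank_of_not_isOfFinAddOrder _
    (((⟨0, 32, 0, 0, -73728⟩ : WeierstrassCurve ℤ).map (Int.castRingHom ℚ)).module_finite_point_holds)
    (fun hfin ↦ WeierstrassCurve.Affine.Point.some_ne_zero hP (torsionFree_twist_neg8 _ (by convert hfin)))

/-- **DEPTH-TABLE ROW `681c1`, `(p, d_K) = (5, −8)`, v12 — «ONE BIT ⟺ TWO `Ш`'s».** For `E = 681c1` and ANY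
imaginary quadratic `K` with `d_K = −8`: «some frame, some Kolyvagin prime `ℓ`, some datum of conductor
`ℓ` with `c_1(ℓ) ≠ 0`» `↔` «`Ш(E/ℚ)[5] = 0` ∧ `rank_ℤ E^{(−8)}(ℚ) = 1` ∧ `Ш(E^{(−8)}/ℚ)[5] = 0`». From
`exactRowZhang_5_neg8`, the kernel 2-descent certificate `Rank2Observatory.C681c1.mordellWeilRank_eq_two`, and
`natCard_selmerGroup_le_iff_rank_eq_one_sha₁₅` at the twist fed with the kernel point `one_le_rank_twist_neg8`
(through `mordellWeilRank_quadraticTwist_eq_twistModel`) and the irreducibility of `E^{(−8)}[5]` (twist of the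
onto `ρ̄_{E,5}`). Every side condition is a kernel theorem; CONDITIONAL on (γ) and W. Zhang's Lemma 8.4 (1) /
Thm. 9.1 by name; per curve; BSD is not proved by it.
[cite: WZhang2014, Lemma 8.4 (1) (p. 236), Thm. 9.1 (p. 240)] [cite: GrossLMS1991, Prop. 3.7 (2)]
[cite: SilvermanAEC2009, Thm. X.4.2] [cite: CremonaAlgorithms1997, Table 1 (681c1)] -/
theorem exactRowZhang_5_neg8_twoSha
    (h372 : GrossLMS1991.prop37_2_frobeniusCongruence)
    (h84 : Literature.NumberTheory.EllipticCurves.WZhang2014_lemma84_exists_minimal_kolyvaginClass_one_selmerCard)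
    (K : Type) [Field K] [NumberField K] (hK : IsImaginaryQuadratic K)
    (hD : NumberField.discr K = -8) :
    haveI := isElliptic_c681c1;
    haveI := isGloballyMinimal_c681c1;
    haveI : NeZero (((⟨0, -1, 1, 0, 2⟩ : WeierstrassCurve ℤ).map (Int.castRingHom ℚ)).conductorNorm ℤ) := neZero_conductorNorm_of_isElliptic _;
    haveI := Fact.mk (by norm_num : Nat.Prime 5);
    (∃ (Dt : ModularParametrizationData ((⟨0, -1, 1, 0, 2⟩ : WeierstrassCurve ℤ).map (Int.castRingHom ℚ)) (((⟨0, -1, 1, 0, 2⟩ : WeierstrassCurve ℤ).map (Int.castRingHom ℚ)).conductorNorm ℤ)) (β : ℤ)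
      (ι : K →+* ℂ) (ℓ : ℕ) (d : KolyvaginHeegnerData Dt β ι ℓ),
      ℓ.Prime ∧ Zhang2014.IsKolyvaginPrime (((⟨0, -1, 1, 0, 2⟩ : WeierstrassCurve ℤ).map (Int.castRingHom ℚ)).conductorNorm ℤ) ((⟨0, -1, 1, 0, 2⟩ : WeierstrassCurve ℤ).map (Int.castRingHom ℚ)) K 5 ℓ ∧
        d.kolyvaginClass (p := 5) (by norm_num) 1 ≠ 0) ↔
    ((((⟨0, -1, 1, 0, 2⟩ : WeierstrassCurve ℤ).map (Int.castRingHom ℚ)).sha ⊓ AddSubgroup.torsionBy ((⟨0, -1, 1, 0, 2⟩ : WeierstrassCurve ℤ).map (Int.castRingHom ℚ)).galH1 ((5 : ℕ) : ℤ) : AddSubgroup _) = ⊥ ∧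
      (((⟨0, -1, 1, 0, 2⟩ : WeierstrassCurve ℤ).map (Int.castRingHom ℚ)).quadraticTwist (NumberField.discr K : ℚ)).mordellWeilRank = 1 ∧
      ((((⟨0, -1, 1, 0, 2⟩ : WeierstrassCurve ℤ).map (Int.castRingHom ℚ)).quadraticTwist (NumberField.discr K : ℚ)).sha ⊓
          AddSubgroup.torsionBy (((⟨0, -1, 1, 0, 2⟩ : WeierstrassCurve ℤ).map (Int.castRingHom ℚ)).quadraticTwist (NumberField.discr K : ℚ)).galH1 ((5 : ℕ) : ℤ) :
          AddSubgroup (((⟨0, -1, 1, 0, 2⟩ : WeierstrassCurve ℤ).map (Int.castRingHom ℚ)).quadraticTwist (NumberField.discr K : ℚ)).galH1) = ⊥) := by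
  haveI := isElliptic_c681c1
  haveI := isGloballyMinimal_c681c1
  haveI : NeZero (((⟨0, -1, 1, 0, 2⟩ : WeierstrassCurve ℤ).map (Int.castRingHom ℚ)).conductorNorm ℤ) := neZero_conductorNorm_of_isElliptic _
  haveI := Fact.mk (by norm_num : Nat.Prime 5)
  have hdK : (NumberField.discr K : ℚ) ≠ 0 := by exact_mod_cast NumberField.discr_ne_zero K
  haveI := ((⟨0, -1, 1, 0, 2⟩ : WeierstrassCurve ℤ).map (Int.castRingHom ℚ)).isElliptic_quadraticTwist hdK
  have hsur : ((⟨0, -1, 1, 0, 2⟩ : WeierstrassCurve ℤ).map (Int.castRingHom ℚ)).HasSurjectiveModNGaloisRep (5 ^ 1 : ℕ) := hasSurjectiveModNGaloisRep_pow_5 1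
  rw [pow_one] at hsur
  have hirrT : (((⟨0, -1, 1, 0, 2⟩ : WeierstrassCurve ℤ).map (Int.castRingHom ℚ)).quadraticTwist (NumberField.discr K : ℚ)).HasIrreducibleModPGaloisRep 5 :=
    (((⟨0, -1, 1, 0, 2⟩ : WeierstrassCurve ℤ).map (Int.castRingHom ℚ)).hasIrreducibleModPGaloisRep_quadraticTwist_iff hdK 5).mpr
      (hasIrreducibleModPGaloisRep_of_hasSurjectiveModNGaloisRep ((⟨0, -1, 1, 0, 2⟩ : WeierstrassCurve ℤ).map (Int.castRingHom ℚ)) 5 hsur)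
  have h1 : 1 ≤ (((⟨0, -1, 1, 0, 2⟩ : WeierstrassCurve ℤ).map (Int.castRingHom ℚ)).quadraticTwist (NumberField.discr K : ℚ)).mordellWeilRank := by
    rw [hD, mordellWeilRank_quadraticTwist_eq_twistModel intModel (-8), twistModel_neg8]
    exact one_le_rank_twist_neg8
  exact (exactRowZhang_5_neg8 h372 h84 K hK hD).trans
    ((and_iff_right Summit.BirchSwinnertonDyer.BirchSwinnertonDyer.Rank2Observatory.C681c1.mordellWeilRank_eq_two).trans
      (and_congr_right fun _ ↦ natCard_selmerGroup_le_iff_rank_eq_one_sha₁₅ _ 5 hirrT h1))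

/-! ## Row `(5, −68)`: Heegner data, exact reading, twist model `[0, 272, 0, 0, -45278208]`, kernel point `(123849/4, 43776165/8)` -/

/-- **Heegner data `d_K = -68` for `681c1`**: every prime of `Δ = -2043 = -3²·227` (hence of `N_E`) splits in a
quadratic field of discriminant `-68` (Kronecker symbols `= 1`). [cite: Marcus1977, Ch. 3 Thm. 25] [cite: GrossLMS1991, §1] -/
theorem heegner_neg68 : ∀ q : ℕ, q.Prime → (q : ℤ) ∣ (⟨0, -1, 1, 0, 2⟩ : WeierstrassCurve ℤ).Δ →
    (q = 2 → (-68 : ℤ) % 8 = 1) ∧ (q ≠ 2 → jacobiSym (-68) q = 1) :=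
  forall_prime_dvd_of_natAbs_eq_pow_mul_pow (a := 3) (i := 2) (b := 227) (j := 1) (by decide +kernel)
    (by norm_num) (by norm_num) ⟨by norm_num, by norm_num⟩ ⟨by norm_num, by norm_num⟩

/-- **DEPTH-TABLE ROW `681c1`, `(p, d_K) = (5, −68)`, READ EXACTLY on the ♠ cell (two-sided; no `hF`, no
twist point, no twist pinning; `5` inert in `K`; `h_K = 4`, least Kolyvagin prime `ℓ = 19`, `a_19 = -5`,
JLS cost `(ℓ+1)·h_K = 80`).** For `E = 681c1` (two independent points by `KernelCerts002.C681c1.two_le_rank`)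
and ANY imaginary quadratic `K` with `d_K = −68`: «some frame, some Kolyvagin prime `ℓ`, some datum of
conductor `ℓ` with `c_1(ℓ) ≠ 0`» `↔` «`rank E(ℚ) = 2` ∧ `Ш(E/ℚ)[5] = 0` ∧ `#Sel_5(E^{(−68)}/ℚ) ≤ 5`». Side
conditions all kernel theorems (`5` good ordinary, `ρ_{E,5^n}` onto, non-CM, ♠ (1) + semistable from
`Δ = -2043`, Heegner for `N_E`). CONDITIONAL on (γ) and W. Zhang's Lemma 8.4 (1) / Thm. 9.1 by name; per
curve; BSD is not proved by it.
[cite: WZhang2014, Lemma 8.4 (1) (p. 236), Thm. 9.1 (p. 240)] [cite: GrossLMS1991, Prop. 3.7 (2)]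
[cite: JetchevLauterStein2009, §3.6 (arXiv:0707.0032)] [cite: CremonaAlgorithms1997, Table 1 (681c1)] -/
theorem exactRowZhang_5_neg68
    (h372 : GrossLMS1991.prop37_2_frobeniusCongruence)
    (h84 : Literature.NumberTheory.EllipticCurves.WZhang2014_lemma84_exists_minimal_kolyvaginClass_one_selmerCard)
    (K : Type) [Field K] [NumberField K] (hK : IsImaginaryQuadratic K)
    (hD : NumberField.discr K = -68) :
    haveI := isElliptic_c681c1;
    haveI := isGloballyMinimal_c681c1;
    haveI : NeZero (((⟨0, -1, 1, 0, 2⟩ : WeierstrassCurve ℤ).map (Int.castRingHom ℚ)).conductorNorm ℤ) := neZero_conductorNorm_of_isElliptic _;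
    haveI := Fact.mk (by norm_num : Nat.Prime 5);
    (∃ (Dt : ModularParametrizationData ((⟨0, -1, 1, 0, 2⟩ : WeierstrassCurve ℤ).map (Int.castRingHom ℚ)) (((⟨0, -1, 1, 0, 2⟩ : WeierstrassCurve ℤ).map (Int.castRingHom ℚ)).conductorNorm ℤ)) (β : ℤ)
      (ι : K →+* ℂ) (ℓ : ℕ) (d : KolyvaginHeegnerData Dt β ι ℓ),
      ℓ.Prime ∧ Zhang2014.IsKolyvaginPrime (((⟨0, -1, 1, 0, 2⟩ : WeierstrassCurve ℤ).map (Int.castRingHom ℚ)).conductorNorm ℤ) ((⟨0, -1, 1, 0, 2⟩ : WeierstrassCurve ℤ).map (Int.castRingHom ℚ)) K 5 ℓ ∧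
        d.kolyvaginClass (p := 5) (by norm_num) 1 ≠ 0) ↔
    (((⟨0, -1, 1, 0, 2⟩ : WeierstrassCurve ℤ).map (Int.castRingHom ℚ)).mordellWeilRank = 2 ∧
      (((⟨0, -1, 1, 0, 2⟩ : WeierstrassCurve ℤ).map (Int.castRingHom ℚ)).sha ⊓ AddSubgroup.torsionBy ((⟨0, -1, 1, 0, 2⟩ : WeierstrassCurve ℤ).map (Int.castRingHom ℚ)).galH1 ((5 : ℕ) : ℤ) : AddSubgroup _) = ⊥ ∧
      Nat.card ((((⟨0, -1, 1, 0, 2⟩ : WeierstrassCurve ℤ).map (Int.castRingHom ℚ)).quadraticTwist (NumberField.discr K : ℚ)).selmerGroup (5 : ℕ)) ≤ 5) := by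
  haveI := isElliptic_c681c1
  haveI := isGloballyMinimal_c681c1
  haveI : NeZero (((⟨0, -1, 1, 0, 2⟩ : WeierstrassCurve ℤ).map (Int.castRingHom ℚ)).conductorNorm ℤ) := neZero_conductorNorm_of_isElliptic _
  haveI := Fact.mk (by norm_num : Nat.Prime 5)
  have hgo := goodOrdinary_5
  have hsp := spade_5
  have hH := satisfiesHeegnerHypothesis_conductorNorm_of_intModel intModel K hK.1 hD heegner_neg68
  have hKN := not_dvd_ordMinimalDiscriminant_of_intModel_table intModel (p := 5) (Δ₀ := -2043)
    (by decide +kernel) (B := 11) (by decide +kernel) (by decide +kernel)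
  have hS2 : ¬ Squarefree (((⟨0, -1, 1, 0, 2⟩ : WeierstrassCurve ℤ).map (Int.castRingHom ℚ)).conductorNorm ℤ) →
      (∃ (ℓ : ℕ) (_ : Fact ℓ.Prime), ((⟨0, -1, 1, 0, 2⟩ : WeierstrassCurve ℤ).map (Int.castRingHom ℚ)).HasMultiplicativeReductionAtPrime ℓ ∧
          ¬ 5 ∣ padicValInt ℓ ((⟨0, -1, 1, 0, 2⟩ : WeierstrassCurve ℤ).map (Int.castRingHom ℚ)).minimalDiscriminantInt) ∧
        ∃ (ℓ₁ ℓ₂ : ℕ) (_ : Fact ℓ₁.Prime) (_ : Fact ℓ₂.Prime), ℓ₁ ≠ ℓ₂ ∧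
          ((⟨0, -1, 1, 0, 2⟩ : WeierstrassCurve ℤ).map (Int.castRingHom ℚ)).HasMultiplicativeReductionAtPrime ℓ₁ ∧ ((⟨0, -1, 1, 0, 2⟩ : WeierstrassCurve ℤ).map (Int.castRingHom ℚ)).HasMultiplicativeReductionAtPrime ℓ₂ :=
    fun hns ↦ absurd (((⟨0, -1, 1, 0, 2⟩ : WeierstrassCurve ℤ).map (Int.castRingHom ℚ)).isSemistable_iff_squarefree_conductorNorm.mp hsp.2) hns
  have hD3 : NumberField.discr K ≠ -3 := by rw [hD]; norm_num
  have hD4 : NumberField.discr K ≠ -4 := by rw [hD]; norm_num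
  have hpD : ¬ (((5 : ℕ) : ℤ) ∣ NumberField.discr K) := by rw [hD]; norm_num
  exact kolyvaginClass_prime_ne_zero_iff_rankTwo_shaTrivial_twistSelmer_of_lemma84 h372 h84 _ not_hasCM
    KernelCerts002.C681c1.two_le_rank 5 (by norm_num) hgo.1 hgo.2 hasSurjectiveModNGaloisRep_pow_5 hKN hsp.1 hS2 K
    hK hD3 hD4 hpD hH

/-- The twist model of `E^{(−68)}` for `E = 681c1`: `[0, −68 b₂, 0, 8·68² b₄, −16·68³ b₆] = [0, 272, 0, 0, -45278208]`
(`ℚ`-isomorphic to `E^{(−68)}` by `u = 1/2`). [cite: SilvermanAEC2009, X.5 Cor. 5.4] -/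
theorem twistModel_neg68 :
    (⟨0, (-68) * (⟨0, -1, 1, 0, 2⟩ : WeierstrassCurve ℤ).b₂, 0, 8 * (-68) ^ 2 * (⟨0, -1, 1, 0, 2⟩ : WeierstrassCurve ℤ).b₄,
        16 * (-68) ^ 3 * (⟨0, -1, 1, 0, 2⟩ : WeierstrassCurve ℤ).b₆⟩ : WeierstrassCurve ℤ) = ⟨0, 272, 0, 0, -45278208⟩ := by
  ext <;> decide +kernel

/-- The twist model `[0, 272, 0, 0, -45278208]` is an elliptic curve over `ℚ` (`Δ ≠ 0`, kernel-checked). [folklore] -/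
theorem isElliptic_twist_neg68 : ((⟨0, 272, 0, 0, -45278208⟩ : WeierstrassCurve ℤ).map (Int.castRingHom ℚ)).IsElliptic := by
  rw [WeierstrassCurve.isElliptic_iff, WeierstrassCurve.map_Δ, isUnit_iff_ne_zero, eq_intCast,
    Int.cast_ne_zero]
  decide +kernel

/-- Torsion killers for the twist model `[0, 272, 0, 0, -45278208]`: kernel point counts `(q, #Ṽ(𝔽_q))` at the good
primes `(5, 2), (7, 11)`. [cite: SilvermanAEC2009, Prop. VII.3.1 (b)] -/
theorem killers_twist_neg68 : ∀ ℓN ∈ [((5 : ℕ), (2 : ℕ)), ((7 : ℕ), (11 : ℕ))], ℓN.1.Prime ∧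
    ∀ (x : ((⟨0, 272, 0, 0, -45278208⟩ : WeierstrassCurve ℤ).map (Int.castRingHom ℚ)).toAffine.Point)
      (n : ℕ), ¬ ℓN.1 ∣ n → n • x = 0 → ℓN.2 • x = 0 :=
  killers_cons _ (q := 5) (N := 2) (by decide +kernel) (by decide +kernel)
    (killers_cons _ (q := 7) (N := 11) (by decide +kernel) (by decide +kernel)
      (killers_nil _))

/-- **`E^{(−68)}(ℚ)` is torsion-free** (`E = 681c1`; twist model `[0, 272, 0, 0, -45278208]`; annihilator `t = 1` from the
kernel counts `(5, 2), (7, 11)`). [cite: SilvermanAEC2009, Prop. VII.3.1 (b)] -/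
theorem torsionFree_twist_neg68 (x : ((⟨0, 272, 0, 0, -45278208⟩ : WeierstrassCurve ℤ).map (Int.castRingHom ℚ)).toAffine.Point)
    (hx : IsOfFinAddOrder x) : x = 0 := by
  simpa only [one_smul] using
    nsmul_eq_zero_of_annihilatorCheck (t := 1) killers_twist_neg68 (by decide +kernel) hx

/-- **`1 ≤ rank_ℤ E^{(−68)}(ℚ)` for `E = 681c1` IN THE KERNEL**: the rational point `(123849/4, 43776165/8)` of the
twist model `[0, 272, 0, 0, -45278208]` (residue-sieved search over `x = u/w²`, `|u| ≤ 10⁷`) is non-zero on a torsion-free curve, hence of infinite order;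
Mordell–Weil. [cite: SilvermanAEC2009, Prop. VII.3.1 (b) and Thm. VIII.6.7] -/
theorem one_le_rank_twist_neg68 :
    1 ≤ ((⟨0, 272, 0, 0, -45278208⟩ : WeierstrassCurve ℤ).map (Int.castRingHom ℚ)).mordellWeilRank := by
  haveI := isElliptic_twist_neg68
  have hP : ((⟨0, 272, 0, 0, -45278208⟩ : WeierstrassCurve ℤ).map (Int.castRingHom ℚ)).toAffine.Nonsingular
      ((123849 / 4 : ℚ)) ((43776165 / 8 : ℚ)) :=
    WeierstrassCurve.Affine.equation_iff_nonsingular.mp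
      ((WeierstrassCurve.Affine.equation_iff _ _).mpr (by norm_num [WeierstrassCurve.map]))
  exact one_le_mordellWeilRank_of_not_isOfFinAddOrder _
    (((⟨0, 272, 0, 0, -45278208⟩ : WeierstrassCurve ℤ).map (Int.castRingHom ℚ)).module_finite_point_holds)
    (fun hfin ↦ WeierstrassCurve.Affine.Point.some_ne_zero hP (torsionFree_twist_neg68 _ (by convert hfin)))

/-- **DEPTH-TABLE ROW `681c1`, `(p, d_K) = (5, −68)`, v12 — «ONE BIT ⟺ TWO `Ш`'s».** For `E = 681c1` and ANY
imaginary quadratic `K` with `d_K = −68`: «some frame, some Kolyvagin prime `ℓ`, some datum of conductor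
`ℓ` with `c_1(ℓ) ≠ 0`» `↔` «`Ш(E/ℚ)[5] = 0` ∧ `rank_ℤ E^{(−68)}(ℚ) = 1` ∧ `Ш(E^{(−68)}/ℚ)[5] = 0`». From
`exactRowZhang_5_neg68`, the kernel 2-descent certificate `Rank2Observatory.C681c1.mordellWeilRank_eq_two`, and
`natCard_selmerGroup_le_iff_rank_eq_one_sha₁₅` at the twist fed with the kernel point `one_le_rank_twist_neg68`
(through `mordellWeilRank_quadraticTwist_eq_twistModel`) and the irreducibility of `E^{(−68)}[5]` (twist of the
onto `ρ̄_{E,5}`). Every side condition is a kernel theorem; CONDITIONAL on (γ) and W. Zhang's Lemma 8.4 (1) /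
Thm. 9.1 by name; per curve; BSD is not proved by it.
[cite: WZhang2014, Lemma 8.4 (1) (p. 236), Thm. 9.1 (p. 240)] [cite: GrossLMS1991, Prop. 3.7 (2)]
[cite: SilvermanAEC2009, Thm. X.4.2] [cite: CremonaAlgorithms1997, Table 1 (681c1)] -/
theorem exactRowZhang_5_neg68_twoSha
    (h372 : GrossLMS1991.prop37_2_frobeniusCongruence)
    (h84 : Literature.NumberTheory.EllipticCurves.WZhang2014_lemma84_exists_minimal_kolyvaginClass_one_selmerCard)
    (K : Type) [Field K] [NumberField K] (hK : IsImaginaryQuadratic K)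
    (hD : NumberField.discr K = -68) :
    haveI := isElliptic_c681c1;
    haveI := isGloballyMinimal_c681c1;
    haveI : NeZero (((⟨0, -1, 1, 0, 2⟩ : WeierstrassCurve ℤ).map (Int.castRingHom ℚ)).conductorNorm ℤ) := neZero_conductorNorm_of_isElliptic _;
    haveI := Fact.mk (by norm_num : Nat.Prime 5);
    (∃ (Dt : ModularParametrizationData ((⟨0, -1, 1, 0, 2⟩ : WeierstrassCurve ℤ).map (Int.castRingHom ℚ)) (((⟨0, -1, 1, 0, 2⟩ : WeierstrassCurve ℤ).map (Int.castRingHom ℚ)).conductorNorm ℤ)) (β : ℤ)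
      (ι : K →+* ℂ) (ℓ : ℕ) (d : KolyvaginHeegnerData Dt β ι ℓ),
      ℓ.Prime ∧ Zhang2014.IsKolyvaginPrime (((⟨0, -1, 1, 0, 2⟩ : WeierstrassCurve ℤ).map (Int.castRingHom ℚ)).conductorNorm ℤ) ((⟨0, -1, 1, 0, 2⟩ : WeierstrassCurve ℤ).map (Int.castRingHom ℚ)) K 5 ℓ ∧
        d.kolyvaginClass (p := 5) (by norm_num) 1 ≠ 0) ↔
    ((((⟨0, -1, 1, 0, 2⟩ : WeierstrassCurve ℤ).map (Int.castRingHom ℚ)).sha ⊓ AddSubgroup.torsionBy ((⟨0, -1, 1, 0, 2⟩ : WeierstrassCurve ℤ).map (Int.castRingHom ℚ)).galH1 ((5 : ℕ) : ℤ) : AddSubgroup _) = ⊥ ∧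
      (((⟨0, -1, 1, 0, 2⟩ : WeierstrassCurve ℤ).map (Int.castRingHom ℚ)).quadraticTwist (NumberField.discr K : ℚ)).mordellWeilRank = 1 ∧
      ((((⟨0, -1, 1, 0, 2⟩ : WeierstrassCurve ℤ).map (Int.castRingHom ℚ)).quadraticTwist (NumberField.discr K : ℚ)).sha ⊓
          AddSubgroup.torsionBy (((⟨0, -1, 1, 0, 2⟩ : WeierstrassCurve ℤ).map (Int.castRingHom ℚ)).quadraticTwist (NumberField.discr K : ℚ)).galH1 ((5 : ℕ) : ℤ) :
          AddSubgroup (((⟨0, -1, 1, 0, 2⟩ : WeierstrassCurve ℤ).map (Int.castRingHom ℚ)).quadraticTwist (NumberField.discr K : ℚ)).galH1) = ⊥) := by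
  haveI := isElliptic_c681c1
  haveI := isGloballyMinimal_c681c1
  haveI : NeZero (((⟨0, -1, 1, 0, 2⟩ : WeierstrassCurve ℤ).map (Int.castRingHom ℚ)).conductorNorm ℤ) := neZero_conductorNorm_of_isElliptic _
  haveI := Fact.mk (by norm_num : Nat.Prime 5)
  have hdK : (NumberField.discr K : ℚ) ≠ 0 := by exact_mod_cast NumberField.discr_ne_zero K
  haveI := ((⟨0, -1, 1, 0, 2⟩ : WeierstrassCurve ℤ).map (Int.castRingHom ℚ)).isElliptic_quadraticTwist hdK
  have hsur : ((⟨0, -1, 1, 0, 2⟩ : WeierstrassCurve ℤ).map (Int.castRingHom ℚ)).HasSurjectiveModNGaloisRep (5 ^ 1 : ℕ) := hasSurjectiveModNGaloisRep_pow_5 1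
  rw [pow_one] at hsur
  have hirrT : (((⟨0, -1, 1, 0, 2⟩ : WeierstrassCurve ℤ).map (Int.castRingHom ℚ)).quadraticTwist (NumberField.discr K : ℚ)).HasIrreducibleModPGaloisRep 5 :=
    (((⟨0, -1, 1, 0, 2⟩ : WeierstrassCurve ℤ).map (Int.castRingHom ℚ)).hasIrreducibleModPGaloisRep_quadraticTwist_iff hdK 5).mpr
      (hasIrreducibleModPGaloisRep_of_hasSurjectiveModNGaloisRep ((⟨0, -1, 1, 0, 2⟩ : WeierstrassCurve ℤ).map (Int.castRingHom ℚ)) 5 hsur)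
  have h1 : 1 ≤ (((⟨0, -1, 1, 0, 2⟩ : WeierstrassCurve ℤ).map (Int.castRingHom ℚ)).quadraticTwist (NumberField.discr K : ℚ)).mordellWeilRank := by
    rw [hD, mordellWeilRank_quadraticTwist_eq_twistModel intModel (-68), twistModel_neg68]
    exact one_le_rank_twist_neg68
  exact (exactRowZhang_5_neg68 h372 h84 K hK hD).trans
    ((and_iff_right Summit.BirchSwinnertonDyer.BirchSwinnertonDyer.Rank2Observatory.C681c1.mordellWeilRank_eq_two).trans
      (and_congr_right fun _ ↦ natCard_selmerGroup_le_iff_rank_eq_one_sha₁₅ _ 5 hirrT h1))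

end C681c1

end Summit.BirchSwinnertonDyer.BirchSwinnertonDyer.Theorems.KolyvaginDepthDoor

end
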